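import Mathlib
import Literature.AlgebraicGeometry.Resolution.FacePreparation
import HarnessLib

/-!
# Preparation at the upper `δ`-vertex `w⁺`

Topic: `Literature/AlgebraicGeometry/Resolution`. The mirror image of `FacePreparation` for the
vertex `w⁺ = (δ − γ⁺, γ⁺)` of the `δ`-face (Cossart–Jannsen–Saito, LNM 2270, Proposition 14.3
(b): "`(f, y, u)` is `v`-prepared and prepared at `w⁺(f, y, u)`", obtained by Lemma 11.4;
Cossart–Piltant 2008, p. 12, non-rational case). Canonical supporting line:
`(N+1) x₁ + N x₂ = (N+1) δs − γ⁺s` with `N = δs + 1`, which meets the polygon only at `w⁺`.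
PROVED (no facts):

* `WPlusPrepared c J μ` — `w⁺` is not solvable along its canonical line;
* `forall_pts_wPlusWeight`, `eq_wPlus_of_wPlusLine` — validity and uniqueness;
* `dissolve_wPlus_step`, `exists_wPlusPrepared` — **preparation at `w⁺` keeping `v`**: finitely
  many dissolutions produce `c⋆ = (y⋆, u₁, u₂)`, `y⋆ − y ∈ 𝔪²`, with the same `α, β`, still
  `v`-prepared, all positive half-planes of `c` valid, `δ` not smaller, and `w⁺` prepared
  (descent on `(α + β − δ, γ⁺)`).

## Sources

* V. Cossart, U. Jannsen, S. Saito, LNM 2270 (2020), Lemma 11.4, Prop. 14.3 (b).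
  [CossartJannsenSaito2020]
* V. Cossart, O. Piltant, J. Algebra 320 (2008), §4, pp. 11–12. [CossartPiltant2008]
-/

noncomputable section

open IsLocalRing MvPolynomial

namespace Literature.AlgebraicGeometry.Resolution

universe u

variable {R : Type u} [CommRing R]

/-! ## The canonical line through `w⁺` -/

section Lines

variable (c : Fin 3 → R) (J : Ideal R) (μ : ℕ)

/-- The tilt `δs + 1` of the canonical line through `w⁺`. [folklore] -/
def tiltPN : ℕ := deltaS c J μ + 1

/-- The level `(N+1) δs − γ⁺s` of the canonical line through `w⁺`. [folklore] -/
def wPlusLevel : ℕ := (tiltPN c J μ + 1) * deltaS c J μ - gammaPlusS c J μ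

/-- The canonical weight through `w⁺ = (δ − γ⁺, γ⁺)`, slightly less steep than the `δ`-face.
[cite: CossartJannsenSaito2020, Prop. 14.3 (b)] -/
def wPlusWeight : Fin 3 → ℕ := levelWeight μ (wPlusLevel c J μ) (tiltPN c J μ + 1) (tiltPN c J μ)

variable [IsRegularLocalRing R] in
/-- **Preparedness at `w⁺`**: the vertex `w⁺` is not solvable along the canonical line.
[cite: CossartJannsenSaito2020, Prop. 14.3 (b)] [cite: CossartPiltant2008, §4 p. 12] -/
def WPlusPrepared (c : Fin 3 → R) (J : Ideal R) (μ : ℕ) : Prop :=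
  ∀ (v₁ v₂ : ℕ) (lam : ResidueField R), deltaS c J μ = μ.factorial * v₁ + gammaPlusS c J μ →
    gammaPlusS c J μ = μ.factorial * v₂ →
      ¬ IsSolvableAt c J (wPlusWeight c J μ) (wPlusLevel c J μ * μ) μ (vexp v₁ v₂) lam

variable {c J μ}

/-- `γ⁺s ≤ δs`. [folklore] -/
theorem gammaPlusS_le_deltaS (hne : (pts c J μ).Nonempty) : gammaPlusS c J μ ≤ deltaS c J μ := by
  obtain ⟨e, -, hsum, h2⟩ := exists_pts_wPlus hne
  omega

/-- The canonical line through `w⁺` supports the polygon. [cite: CossartJannsenSaito2020, Lemma 11.4] -/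
theorem forall_pts_wPlusWeight :
    ∀ e ∈ pts c J μ, wPlusLevel c J μ ≤ (tiltPN c J μ + 1) * spt₁ μ e + tiltPN c J μ * spt₂ μ e := by
  intro e he
  have hne : (pts c J μ).Nonempty := ⟨e, he⟩
  have hγδ := gammaPlusS_le_deltaS hne
  rw [wPlusLevel, tiltPN]
  have hsplit : (deltaS c J μ + 1 + 1) * spt₁ μ e + (deltaS c J μ + 1) * spt₂ μ e =
      (deltaS c J μ + 1) * (spt₁ μ e + spt₂ μ e) + spt₁ μ e := by ring
  rw [hsplit]
  have hδ := deltaS_le he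
  rcases hδ.eq_or_lt with heq | hlt
  · have hγ := le_gammaPlusS he heq.symm
    rw [← heq]
    have : (deltaS c J μ + 1 + 1) * deltaS c J μ = (deltaS c J μ + 1) * deltaS c J μ + deltaS c J μ := by
      ring
    rw [this]; omega
  · have h1 : deltaS c J μ + 1 ≤ spt₁ μ e + spt₂ μ e := hlt
    have h2 := Nat.mul_le_mul_left (deltaS c J μ + 1) h1
    have : (deltaS c J μ + 1 + 1) * deltaS c J μ = (deltaS c J μ + 1) * deltaS c J μ + deltaS c J μ := by
      ring
    rw [this]
    rw [Nat.mul_add, mul_one] at h2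
    omega

/-- The canonical line through `w⁺` meets the polygon only at `w⁺`. [cite: CossartJannsenSaito2020, Lemma 11.4] -/
theorem eq_wPlus_of_wPlusLine {e : Fin 3 →₀ ℕ} (he : e ∈ pts c J μ)
    (h : (tiltPN c J μ + 1) * spt₁ μ e + tiltPN c J μ * spt₂ μ e = wPlusLevel c J μ) :
    spt₁ μ e + spt₂ μ e = deltaS c J μ ∧ spt₂ μ e = gammaPlusS c J μ := by
  have hne : (pts c J μ).Nonempty := ⟨e, he⟩
  have hγδ := gammaPlusS_le_deltaS hne
  rw [wPlusLevel, tiltPN] at h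
  have hsplit : (deltaS c J μ + 1 + 1) * spt₁ μ e + (deltaS c J μ + 1) * spt₂ μ e =
      (deltaS c J μ + 1) * (spt₁ μ e + spt₂ μ e) + spt₁ μ e := by ring
  rw [hsplit] at h
  have hexp : (deltaS c J μ + 1 + 1) * deltaS c J μ = (deltaS c J μ + 1) * deltaS c J μ + deltaS c J μ := by
    ring
  rw [hexp] at h
  have hδ := deltaS_le he
  rcases hδ.eq_or_lt with heq | hlt
  · have hγ := le_gammaPlusS he heq.symm
    rw [← heq] at h
    exact ⟨heq.symm, by omega⟩
  · exfalso
    have h1 : deltaS c J μ + 1 ≤ spt₁ μ e + spt₂ μ e := hlt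
    have h2 := Nat.mul_le_mul_left (deltaS c J μ + 1) h1
    rw [Nat.mul_add, mul_one] at h2
    omega

end Lines

/-! ## One dissolution at `w⁺` -/

section Step

variable [IsRegularLocalRing R] (c : Fin 3 → R)
  (hgen : Ideal.span {c 0, c 1, c 2} = maximalIdeal R) (hdim : ringKrullDim R = 3)
  {J : Ideal R} {μ : ℕ} (lam : R) {v₁ v₂ : ℕ}

omit [IsRegularLocalRing R] in
/-- If `w⁺ ≠ v`, then `w⁺` lies strictly beyond every steep line through `v`:
`N αs + βs < N (δs − γ⁺s) + γ⁺s` for `N ≥ βs + 1`. [folklore] -/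
theorem steep_lt_of_wPlus_ne (hne : (pts c J μ).Nonempty)
    (hvw : ¬ (deltaS c J μ = alphaS c J μ + gammaPlusS c J μ ∧ gammaPlusS c J μ = betaS c J μ))
    {N : ℕ} (hN : betaS c J μ + 1 ≤ N) :
    N * alphaS c J μ + betaS c J μ < N * (deltaS c J μ - gammaPlusS c J μ) + gammaPlusS c J μ := by
  obtain ⟨e, he, hsum, h2⟩ := exists_pts_wPlus hne
  have hα := alphaS_le he
  have hγβ : gammaPlusS c J μ ≤ betaS c J μ := gammaPlusS_le_betaS hne
  have hw1 : deltaS c J μ - gammaPlusS c J μ = spt₁ μ e := by omega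
  rw [hw1]
  rcases hα.eq_or_lt with heq | hlt
  · have hβ := betaS_le he heq.symm
    exfalso; apply hvw
    rw [h2] at hβ
    exact ⟨by omega, le_antisymm hγβ hβ⟩
  · have h1 : alphaS c J μ + 1 ≤ spt₁ μ e := hlt
    have := Nat.mul_le_mul_left N h1
    rw [Nat.mul_add, mul_one] at this
    omega

local notation "c'" => shiftZ c (shiftMon c lam v₁ v₂)

include hgen hdim in
/-- **One dissolution at `w⁺`**: suppose `v` is prepared, `w⁺ = L (v₁, v₂)` is solvable by the
residue of `λ` along the canonical line, and `L < δs`. Then for `c′ = (y + λ u₁^{v₁} u₂^{v₂}, u)`: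
`𝔪` is still generated; every positive half-plane of `c` is valid for `c′`; `α, β` are unchanged;
`v` stays prepared; `δ` does not drop; if `δ` is unchanged then `γ⁺` decreases; `y′ − y ∈ 𝔪²`.
[cite: CossartJannsenSaito2020, Lemma 11.4, Thm. 8.16] [cite: CossartPiltant2008, §4 p. 12] -/
theorem dissolve_wPlus_step (hJne : (pts c J μ).Nonempty) (hδ : μ.factorial < deltaS c J μ)
    (hvprep : VPrepared c J μ)
    (hw1 : deltaS c J μ = μ.factorial * v₁ + gammaPlusS c J μ)
    (hw2 : gammaPlusS c J μ = μ.factorial * v₂)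
    (hsolv : IsSolvableAt c J (wPlusWeight c J μ) (wPlusLevel c J μ * μ) μ (vexp v₁ v₂)
      (residue R lam)) :
    Ideal.span {c' 0, c' 1, c' 2} = maximalIdeal R ∧
    (∀ (w₀ p₁ p₂ : ℕ), 0 < w₀ → 0 < p₁ → 0 < p₂ →
      (∀ e ∈ pts c J μ, w₀ ≤ p₁ * spt₁ μ e + p₂ * spt₂ μ e) →
        ∀ e ∈ pts c' J μ, w₀ ≤ p₁ * spt₁ μ e + p₂ * spt₂ μ e) ∧
    (pts c' J μ).Nonempty ∧ alphaS c' J μ = alphaS c J μ ∧ betaS c' J μ = betaS c J μ ∧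
    VPrepared c' J μ ∧ deltaS c J μ ≤ deltaS c' J μ ∧
    (deltaS c' J μ = deltaS c J μ → gammaPlusS c' J μ < gammaPlusS c J μ) ∧
    c' 0 - c 0 ∈ maximalIdeal R ^ 2 := by
  -- the point `e_w` realising `w⁺`
  obtain ⟨ew, hew, hsum, hew2⟩ := exists_pts_wPlus hJne
  have hew1 : spt₁ μ ew = μ.factorial * v₁ := by omega
  have hew2' : spt₂ μ ew = μ.factorial * v₂ := by omega
  have hγδ := gammaPlusS_le_deltaS hJne
  have hv2 : 2 ≤ v₁ + v₂ := by
    by_contra hlt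
    push Not at hlt
    have hδ' : deltaS c J μ = μ.factorial * (v₁ + v₂) := by rw [Nat.mul_add]; omega
    have : μ.factorial * (v₁ + v₂) ≤ μ.factorial * 1 := Nat.mul_le_mul_left _ (by omega)
    omega
  have hv : 0 < v₁ + v₂ := by omega
  have hgen' : Ideal.span {c' 0, c' 1, c' 2} = maximalIdeal R := by
    rw [span_triple_shiftZ c lam hv]; exact hgen
  -- transfer of half-planes
  have htrans : ∀ (w₀ p₁ p₂ : ℕ), 0 < w₀ → 0 < p₁ → 0 < p₂ →
      (∀ e ∈ pts c J μ, w₀ ≤ p₁ * spt₁ μ e + p₂ * spt₂ μ e) →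
        ∀ e ∈ pts c' J μ, w₀ ≤ p₁ * spt₁ μ e + p₂ * spt₂ μ e :=
    fun w₀ p₁ p₂ hw₀ hp₁ hp₂ hS =>
      forall_pts_shiftZ_of_forall_pts c hgen hdim lam hv hew hew1 hew2' hw₀ hp₁ hp₂ hS
  -- `w⁺ ≠ v` since `v` is prepared and `w⁺` is solvable (same-vertex transfer)
  have hvw : ¬ (deltaS c J μ = alphaS c J μ + gammaPlusS c J μ ∧
      gammaPlusS c J μ = betaS c J μ) := by
    rintro ⟨h1, h2⟩
    have hα : alphaS c J μ = μ.factorial * v₁ := by omega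
    have hβ : betaS c J μ = μ.factorial * v₂ := by omega
    refine hvprep v₁ v₂ (residue R lam) hα hβ ?_
    have hlev_pos : 0 < wPlusLevel c J μ := by
      rw [wPlusLevel, tiltPN]
      have : (deltaS c J μ + 1 + 1) * deltaS c J μ ≥ 2 * deltaS c J μ :=
        Nat.mul_le_mul_right _ (by omega)
      omega
    have key := isSolvableAt_iff_of_same_vertex c hgen hdim (J := J) (μ := μ)
      (w₀ := vLevel c J μ) (p₁ := steepN c J μ) (p₂ := 1)
      (q₀ := wPlusLevel c J μ) (q₁ := tiltPN c J μ + 1) (q₂ := tiltPN c J μ) (v₁ := v₁) (v₂ := v₂)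
      (by rw [vLevel, steepN]; nlinarith) (by rw [steepN]; omega) Nat.one_pos
      hlev_pos (by omega) (by rw [tiltPN]; omega)
      (by rw [vLevel, ← hα, ← hβ]; ring)
      (by
        rw [wPlusLevel, hw1, hw2]
        have : (tiltPN c J μ + 1) * (μ.factorial * v₁ + μ.factorial * v₂) =
            (tiltPN c J μ + 1) * (μ.factorial * v₁) + tiltPN c J μ * (μ.factorial * v₂) +
              μ.factorial * v₂ := by ring
        rw [this, Nat.add_sub_cancel])
      forall_pts_vWeight forall_pts_wPlusWeight
      (fun e he h => by
        obtain ⟨ha, hb⟩ := eq_v_of_vLine he h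
        exact ⟨by rw [ha, hα], by rw [hb, hβ]⟩)
      (fun e he h => by
        obtain ⟨hs, hb⟩ := eq_wPlus_of_wPlusLine he h
        exact ⟨by omega, by omega⟩)
      (residue R lam)
    exact key.mpr hsolv
  -- `v` is preserved
  obtain ⟨ev, hev, hev1, hev2⟩ := exists_pts_v hJne
  have hfarN : ∀ {N : ℕ}, betaS c J μ + 1 ≤ N →
      N * alphaS c J μ + betaS c J μ < μ.factorial * (N * v₁ + 1 * v₂) := by
    intro N hN
    have := steep_lt_of_wPlus_ne c hJne hvw hN
    have hw1' : deltaS c J μ - gammaPlusS c J μ = μ.factorial * v₁ := by omega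
    rw [hw1', hw2] at this
    have hre : μ.factorial * (N * v₁ + 1 * v₂) = N * (μ.factorial * v₁) + μ.factorial * v₂ := by
      ring
    rw [hre]; exact this
  have hpos_v : 0 < steepN c J μ * spt₁ μ ev + 1 * spt₂ μ ev := by
    have := deltaS_le_alphaS_add_betaS hJne
    rw [hev1, hev2, steepN, one_mul]
    nlinarith
  have hmin_v : ∀ x ∈ pts c J μ,
      steepN c J μ * spt₁ μ ev + 1 * spt₂ μ ev ≤ steepN c J μ * spt₁ μ x + 1 * spt₂ μ x := by
    intro x hx
    rw [hev1, hev2]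
    have := forall_pts_vWeight x hx
    rw [vLevel] at this
    omega
  have hev' : ev ∈ pts c' J μ :=
    mem_pts_shiftZ_of_isMinOn c hgen hdim lam (by rw [steepN]; omega) Nat.one_pos hev hmin_v hpos_v
      (by rw [hev1, hev2]; simpa only [one_mul] using hfarN (N := steepN c J μ) le_rfl)
  have hne' : (pts c' J μ).Nonempty := ⟨ev, hev'⟩
  -- `α, β` unchanged
  have hsteep' : ∀ N, betaS c J μ + 1 ≤ N → ∀ e ∈ pts c' J μ,
      N * alphaS c J μ + betaS c J μ ≤ N * spt₁ μ e + 1 * spt₂ μ e := by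
    intro N hN
    have hpos : 0 < N * alphaS c J μ + betaS c J μ := by
      have := deltaS_le_alphaS_add_betaS hJne
      have hN1 : 1 ≤ N := by omega
      have : alphaS c J μ ≤ N * alphaS c J μ := Nat.le_mul_of_pos_left _ hN1
      omega
    exact htrans _ _ _ hpos (by omega) Nat.one_pos (forall_pts_steep hN)
  obtain ⟨hα', hβ'⟩ := alphaS_betaS_eq_of_steep hsteep' hev' hev1 hev2
  -- `v` stays prepared
  have hvW : vWeight c' J μ = vWeight c J μ := by
    simp only [vWeight, vLevel, steepN, hα', hβ']
  have hvL : vLevel c' J μ = vLevel c J μ := by simp only [vLevel, steepN, hα', hβ']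
  have hvprep' : VPrepared c' J μ := by
    intro w₁ w₂ lam' h1 h2
    rw [hvW, hvL]
    rw [hα'] at h1; rw [hβ'] at h2
    have hwpos : ∀ i, 0 < vWeight c J μ i := by
      refine levelWeight_pos ?_ (by rw [steepN]; omega) Nat.one_pos
      have := hpos_v; rw [hev1, hev2] at this; rw [vLevel]; omega
    have hfar : vWeight c J μ 0 + 1 ≤ v₁ * vWeight c J μ 1 + v₂ * vWeight c J μ 2 := by
      simp only [vWeight, levelWeight_zero, levelWeight_one, levelWeight_two]
      have := hfarN (N := steepN c J μ) le_rfl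
      rw [vLevel]
      have hre : v₁ * (μ.factorial * steepN c J μ) + v₂ * (μ.factorial * 1) =
          μ.factorial * (steepN c J μ * v₁ + 1 * v₂) := by ring
      rw [hre]; omega
    have key := isSolvableAt_shiftZ_iff_far c lam hgen hdim hwpos hv hfar (J := J)
      (n := vLevel c J μ * μ) (μ := μ) (v := vexp w₁ w₂) (lam' := lam')
    intro hsol
    exact hvprep w₁ w₂ lam' h1 h2 (key.mp hsol)
  -- `δ` does not drop
  have hδpos : 0 < deltaS c J μ := by omega
  have hδ' : deltaS c J μ ≤ deltaS c' J μ := by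
    obtain ⟨d, hd, hdd⟩ := exists_pts_deltaS hne'
    have := htrans _ 1 1 hδpos Nat.one_pos Nat.one_pos
      (fun e he => by simpa using deltaS_le he) d hd
    rw [← hdd]; simpa using this
  -- if `δ` is unchanged, `γ⁺` decreases: the dissolved line carries no point of `pts c′`
  have hγ : deltaS c' J μ = deltaS c J μ → gammaPlusS c' J μ < gammaPlusS c J μ := by
    intro hδeq
    have hline : wPlusLevel c J μ = μ.factorial * ((tiltPN c J μ + 1) * v₁ + tiltPN c J μ * v₂) := by
      rw [wPlusLevel, hw1, hw2]
      have : (tiltPN c J μ + 1) * (μ.factorial * v₁ + μ.factorial * v₂) =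
          μ.factorial * ((tiltPN c J μ + 1) * v₁ + tiltPN c J μ * v₂) + μ.factorial * v₂ := by ring
      rw [this, Nat.add_sub_cancel]
    have hlev_pos : 0 < wPlusLevel c J μ := by
      rw [wPlusLevel, tiltPN]
      have : (deltaS c J μ + 1 + 1) * deltaS c J μ ≥ 2 * deltaS c J μ :=
        Nat.mul_le_mul_right _ (by omega)
      omega
    have hlt := lt_of_mem_pts_shiftZ_of_isSolvableAt c hgen hdim lam hv hew hew1 hew2' hlev_pos
      (by omega) (by rw [tiltPN]; omega) hline forall_pts_wPlusWeight hsolv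
    obtain ⟨x, hx, hxsum, hx2⟩ := exists_pts_wPlus hne'
    have h := hlt x hx
    rw [wPlusLevel] at h
    have hsplit : (tiltPN c J μ + 1) * spt₁ μ x + tiltPN c J μ * spt₂ μ x =
        tiltPN c J μ * (spt₁ μ x + spt₂ μ x) + spt₁ μ x := by ring
    rw [hsplit, hxsum, hδeq] at h
    have hexp : (tiltPN c J μ + 1) * deltaS c J μ = tiltPN c J μ * deltaS c J μ + deltaS c J μ := by ring
    rw [hexp] at h
    have hx1 : spt₁ μ x = deltaS c J μ - gammaPlusS c' J μ := by omega
    omega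
  refine ⟨hgen', htrans, hne', hα', hβ', hvprep', hδ', hγ, ?_⟩
  simp only [shiftZ_zero, add_sub_cancel_left]
  exact shiftMon_mem_sq c lam hgen hv2

end Step

/-! ## Iterating: preparation at `w⁺` -/

section Iterate

variable [IsRegularLocalRing R] {J : Ideal R} {μ : ℕ} (hdim : ringKrullDim R = 3)

/-- The descent measure `(αs + βs − δs)(βs + 1) + γ⁺s`. [folklore] -/
def wPlusMeasure (c : Fin 3 → R) (J : Ideal R) (μ : ℕ) : ℕ :=
  (alphaS c J μ + betaS c J μ - deltaS c J μ) * (betaS c J μ + 1) + gammaPlusS c J μ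

include hdim in
/-- **Preparation at `w⁺` keeping `v`** (CJS Lemma 11.4; Prop. 14.3 (b)): if `v` is prepared and
`δ > 1`, finitely many dissolutions at `w⁺` yield `c⋆ = (y⋆, u₁, u₂)` with `y⋆ − y ∈ 𝔪²`, all
positive half-planes of `c` valid for `c⋆`, the same `α, β`, `v` still prepared, `δ⋆ ≥ δ`, and
`w⁺` prepared. [cite: CossartJannsenSaito2020, Lemma 11.4] [cite: CossartPiltant2008, §4 p. 12] -/
theorem exists_wPlusPrepared : ∀ (n : ℕ) (c : Fin 3 → R),
    Ideal.span {c 0, c 1, c 2} = maximalIdeal R → (pts c J μ).Nonempty →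
    μ.factorial < deltaS c J μ → VPrepared c J μ → wPlusMeasure c J μ ≤ n →
    ∃ cs : Fin 3 → R, cs 1 = c 1 ∧ cs 2 = c 2 ∧ cs 0 - c 0 ∈ maximalIdeal R ^ 2 ∧
      Ideal.span {cs 0, cs 1, cs 2} = maximalIdeal R ∧
      (∀ (w₀ p₁ p₂ : ℕ), 0 < w₀ → 0 < p₁ → 0 < p₂ →
        (∀ e ∈ pts c J μ, w₀ ≤ p₁ * spt₁ μ e + p₂ * spt₂ μ e) →
          ∀ e ∈ pts cs J μ, w₀ ≤ p₁ * spt₁ μ e + p₂ * spt₂ μ e) ∧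
      (pts cs J μ).Nonempty ∧ alphaS cs J μ = alphaS c J μ ∧ betaS cs J μ = betaS c J μ ∧
      VPrepared cs J μ ∧ deltaS c J μ ≤ deltaS cs J μ ∧ WPlusPrepared cs J μ := by
  intro n
  induction n with
  | zero =>
    intro c hgen hne hδ hvprep hM
    by_cases hprep : WPlusPrepared c J μ
    · exact ⟨c, rfl, rfl, by simp, hgen, fun _ _ _ _ _ _ hS => hS, hne, rfl, rfl, hvprep, le_rfl, hprep⟩
    · exfalso
      obtain ⟨v₁, v₂, lam', h1, h2, hsol⟩ : ∃ v₁ v₂ lam', deltaS c J μ = μ.factorial * v₁ + gammaPlusS c J μ ∧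
          gammaPlusS c J μ = μ.factorial * v₂ ∧
          IsSolvableAt c J (wPlusWeight c J μ) (wPlusLevel c J μ * μ) μ (vexp v₁ v₂) lam' := by
        simpa [WPlusPrepared] using hprep
      obtain ⟨lam, rfl⟩ := residue_surjective (R := R) lam'
      obtain ⟨-, -, hne', hα', hβ', -, hδ', hγ, -⟩ :=
        dissolve_wPlus_step c hgen hdim lam hne hδ hvprep h1 h2 hsol
      have hM0 : wPlusMeasure c J μ = 0 := by omega
      rw [wPlusMeasure] at hM0
      have hdab := deltaS_le_alphaS_add_betaS hne
      have hdab' := deltaS_le_alphaS_add_betaS hne'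
      rw [hα', hβ'] at hdab'
      have hγ0 : gammaPlusS c J μ = 0 := by omega
      -- `γ⁺ = 0` forces `v₂ = 0`, then `δs = L v₁`; the new `γ⁺` would be `< 0`
      have h0 : (alphaS c J μ + betaS c J μ - deltaS c J μ) * (betaS c J μ + 1) = 0 := by omega
      rcases Nat.mul_eq_zero.mp h0 with h0' | h0'
      · have hδeq : deltaS (shiftZ c (shiftMon c lam v₁ v₂)) J μ = deltaS c J μ := by omega
        have := hγ hδeq
        omega
      · omega
  | succ n ih =>
    intro c hgen hne hδ hvprep hM
    by_cases hprep : WPlusPrepared c J μ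
    · exact ⟨c, rfl, rfl, by simp, hgen, fun _ _ _ _ _ _ hS => hS, hne, rfl, rfl, hvprep, le_rfl, hprep⟩
    · obtain ⟨v₁, v₂, lam', h1, h2, hsol⟩ : ∃ v₁ v₂ lam', deltaS c J μ = μ.factorial * v₁ + gammaPlusS c J μ ∧
          gammaPlusS c J μ = μ.factorial * v₂ ∧
          IsSolvableAt c J (wPlusWeight c J μ) (wPlusLevel c J μ * μ) μ (vexp v₁ v₂) lam' := by
        simpa [WPlusPrepared] using hprep
      obtain ⟨lam, rfl⟩ := residue_surjective (R := R) lam'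
      obtain ⟨hgen', htrans, hne', hα', hβ', hvprep', hδ', hγ, hsq⟩ :=
        dissolve_wPlus_step c hgen hdim lam hne hδ hvprep h1 h2 hsol
      have hM' : wPlusMeasure (shiftZ c (shiftMon c lam v₁ v₂)) J μ ≤ n := by
        have hγβ' : gammaPlusS (shiftZ c (shiftMon c lam v₁ v₂)) J μ ≤ betaS c J μ := by
          rw [← hβ']; exact gammaPlusS_le_betaS hne'
        have hdab := deltaS_le_alphaS_add_betaS hne
        have hdab' := deltaS_le_alphaS_add_betaS hne'
        rw [hα', hβ'] at hdab'
        rw [wPlusMeasure] at hM ⊢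
        rw [hα', hβ']
        rcases hδ'.eq_or_lt with hδeq | hδlt
        · have := hγ hδeq.symm
          rw [← hδeq]
          omega
        · have h3 : alphaS c J μ + betaS c J μ - deltaS (shiftZ c (shiftMon c lam v₁ v₂)) J μ + 1 ≤
              alphaS c J μ + betaS c J μ - deltaS c J μ := by omega
          have h4 := Nat.mul_le_mul_right (betaS c J μ + 1) h3
          rw [Nat.add_mul, one_mul] at h4
          omega
      obtain ⟨cs, hcs1, hcs2, hcs0, hgens, htranss, hnes, hαs, hβs, hvpreps, hδs, hpreps⟩ :=
        ih _ hgen' hne' (lt_of_lt_of_le hδ hδ') hvprep' hM'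
      refine ⟨cs, by rw [hcs1]; rfl, by rw [hcs2]; rfl, ?_, hgens, ?_, hnes, by rw [hαs, hα'],
        by rw [hβs, hβ'], hvpreps, hδ'.trans hδs, hpreps⟩
      · have : cs 0 - c 0 = (cs 0 - shiftZ c (shiftMon c lam v₁ v₂) 0) +
            (shiftZ c (shiftMon c lam v₁ v₂) 0 - c 0) := by ring
        rw [this]; exact Ideal.add_mem _ hcs0 hsq
      · intro w₀ p₁ p₂ hw₀ hp₁ hp₂ hS
        exact htranss w₀ p₁ p₂ hw₀ hp₁ hp₂ (htrans w₀ p₁ p₂ hw₀ hp₁ hp₂ hS)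

end Iterate

end Literature.AlgebraicGeometry.Resolution
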